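import Summits.QuantumAdvantage.QuantumAdvantage.Theorems.SosSandwichQueryHomogeneousRung
import Summits.QuantumAdvantage.QuantumAdvantage.Theorems.SosSandwichHomogeneousPBAAAddrStep
import HarnessLib

/-!
# `K_T` versus the DILATED quantum class `L·Q_T`: the homogeneous rung with constant `L²`

Support theorem for route `SosSandwich`, crux `PseudoBoundedAA` (stmt-QuantumAdvantage-15237), repaired rung
`HomogeneousPBAAT` (stmt-QuantumAdvantage-27399).

Kaniewski–Lee–de Wolf (arXiv:1411.7280, Thm. 12: "quantum query complexity in expectation = sos degree") say that
a polynomial `p` is a sum of squares of degree-`≤ T` polynomials on the cube iff `p = E[payoff]` of some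
`T`-query quantum algorithm with nonnegative payoffs; rescaling the payoffs into `[0,1]` (one ancilla rotation),
this reads `p ∈ L·Q_T` for some DILATION FACTOR `L ≥ 0`, where `Q_T` is the class of `T`-query acceptance
probabilities.  So the route's sandwich class is `K_T = cone(Q_T) ∩ (1 − cone(Q_T))`, and the only parameter
separating a member of `K_T` from a genuine acceptance probability is its dilation `L`.

This file proves that the DEGREE-FREE homogeneous rung of `Q_T` (Escudero Gutiérrez Cor. 1.7, tree theorem
`QueryTopLevel.queryHomogeneousRung`: `∃ i, 4·Var[a]² ≤ Inf_i[a]` for top-homogeneous `T`-query acceptance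
probabilities `a`) DEGRADES EXACTLY BY THE SQUARE OF THE DILATION:

* `dilatedHomogeneousRung` — if `p = L · acceptProb(A)` on the cube for a `T`-query algorithm `A` (`T ≥ 1`,
  any real `L`) and `p` satisfies the Laplacian eigen-equation of order `T`, then `∃ i, 4·Var[p]² ≤ L²·Inf_i[p]`;
* `dilatedTopWeight_sq_le` — without homogeneity: `∃ i, 4·(W^{=2T}[p])² ≤ L²·Inf_i[p]`;
* `dilation_sq_ge` — contrapositive, quantitative: if such a `p` has `Var[p] ≥ v ≥ 0` and all influences `≤ τ`,
  then `4 v² ≤ L² τ`, i.e. the dilation needed to realise `p` by `T` queries is at least `2v/√τ`.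

The companion file `SosSandwichQueryDilationAddress` feeds the address family of `not_HomogeneousPBAA`
(`Var = 1/4`, every influence `1/T`) into `dilation_sq_ge`: `L ≥ √T/2`, so `K_T ⊄ L·Q_T` for every fixed `L` —
the `T`-loss of PB-AA on `K_T` is the statement that `K_T` sticks out of every bounded dilate of `Q_T` — and
records the reduction `HomogeneousPBAAT ⟸ "dilation ≤ poly(T)"`.

All proofs: scaling `p ↦ L⁻¹ p` and the tree theorems; standard axioms.

Sources: EscuderoGutierrez2023 (arXiv:2304.06713) Thm 1.6 / Cor 1.7; KaniewskiLeeDewolf2015 (arXiv:1411.7280)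
Def. 7, Thm. 12; BealsEtAl2001 Lemma 4.1.
-/

noncomputable section

set_option linter.dupNamespace false

namespace Summit.QuantumAdvantage.QuantumAdvantage.Theorems.SosSandwich.QueryDilation

open Finset MvPolynomial Literature.Computability.Cryptography Literature.Computability.QuantumComplexity
open Literature.Computability.Complexity.LowDegree
open Summit.QuantumAdvantage.QuantumAdvantage.Theorems.SosSandwich.QueryTopLevel

variable {N : ℕ}

/-! ### Scaling a polynomial by a constant: cube evaluation, average, variance, influences, Walsh coefficients -/

/-- `E[a·p] = a·E[p]`. [folklore] -/
theorem boolAvg_evalBool_C_mul (a : ℝ) (p : MvPolynomial (Fin N) ℝ) :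
    boolAvg (evalBool (C a * p)) = a * boolAvg (evalBool p) := by
  rw [show evalBool (C a * p) = fun x => a * evalBool p x from funext (AddrWitness.evalBool_C_mul' a p)]
  exact avg_const_mul a _

/-- `Var[a·p] = a²·Var[p]`. [folklore] -/
theorem boolVariance_C_mul (a : ℝ) (p : MvPolynomial (Fin N) ℝ) :
    boolVariance (C a * p) = a ^ 2 * boolVariance p := by
  unfold boolVariance
  have h : (fun x => (evalBool (C a * p) x - boolAvg (evalBool (C a * p))) ^ 2) =
      fun x => a ^ 2 * (evalBool p x - boolAvg (evalBool p)) ^ 2 := by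
    funext x
    rw [boolAvg_evalBool_C_mul, AddrWitness.evalBool_C_mul']
    ring
  rw [h, avg_const_mul]

/-- `Inf_i[a·p] = a²·Inf_i[p]`. [folklore] -/
theorem influence_C_mul (a : ℝ) (i : Fin N) (p : MvPolynomial (Fin N) ℝ) :
    influence i (C a * p) = a ^ 2 * influence i p := by
  unfold influence
  have h : (fun x => (evalBool (C a * p) x - evalBool (C a * p) (flipBit i x)) ^ 2) =
      fun x => a ^ 2 * (evalBool p x - evalBool p (flipBit i x)) ^ 2 := by
    funext x
    rw [AddrWitness.evalBool_C_mul', AddrWitness.evalBool_C_mul']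
    ring
  rw [h, avg_const_mul]

/-- `\widehat{a·g}(S) = a·ĝ(S)`. [cite: ODonnell2014, §1.2] -/
theorem cubeFourierCoeff_const_mul' (a : ℝ) (g : (Fin N → Bool) → ℝ) (S : Finset (Fin N)) :
    cubeFourierCoeff (fun x => a * g x) S = a * cubeFourierCoeff g S := by
  unfold cubeFourierCoeff
  rw [mul_div_assoc', Finset.mul_sum]
  congr 1
  exact Finset.sum_congr rfl fun x _ => by ring

/-- The Laplacian eigen-equation of order `T` is homogeneous: it passes from `p` to `a·p`. [folklore] -/
theorem laplacian_C_mul (a : ℝ) (T : ℕ) (p : MvPolynomial (Fin N) ℝ)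
    (hhom : ∀ x : Fin N → Bool, ∑ i : Fin N, (evalBool p x - evalBool p (Function.update x i (!x i))) =
      4 * (T : ℝ) * (evalBool p x - boolAvg (evalBool p))) (x : Fin N → Bool) :
    ∑ i : Fin N, (evalBool (C a * p) x - evalBool (C a * p) (Function.update x i (!x i))) =
      4 * (T : ℝ) * (evalBool (C a * p) x - boolAvg (evalBool (C a * p))) := by
  simp_rw [AddrWitness.evalBool_C_mul']
  rw [boolAvg_evalBool_C_mul, ← mul_sub, show ∑ i : Fin N, (a * evalBool p x -
      a * evalBool p (Function.update x i (!x i))) = a * ∑ i : Fin N, (evalBool p x -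
      evalBool p (Function.update x i (!x i))) by
    rw [Finset.mul_sum]; exact Finset.sum_congr rfl fun i _ => by ring, hhom x]
  ring

/-! ### The homogeneous rung on the dilated class `L·Q_T` -/

/-- **Dilated homogeneous rung.**  Let `A` be a `T`-query quantum algorithm (`T ≥ 1`), `L` a real number and `p`
a polynomial with `p(x) = L · acceptProb_A(x)` on the cube (i.e. `p ∈ L·Q_T`; by Kaniewski–Lee–de Wolf every sum
of squares of degree-`≤ T` polynomials is of this form for some `L`).  If `p` is top-homogeneous of order `T`
(Laplacian eigen-equation `Σᵢ (p − p∘flipᵢ) = 4T (p − E p)`), then some variable has `Inf_i[p] ≥ 4·Var[p]²/L²`: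
the degree-free constant of Escudero Gutiérrez's Cor. 1.7 on `Q_T` (`L = 1`) degrades exactly by the square of
the dilation. [cite: EscuderoGutierrez2023, Cor 1.7] [cite: KaniewskiLeeDewolf2015, Thm. 12] -/
theorem dilatedHomogeneousRung (A : QQueryAlg N) (hT : 1 ≤ A.queries) (p : MvPolynomial (Fin N) ℝ) (L : ℝ)
    (hp : ∀ x, evalBool p x = L * A.acceptProb x)
    (hhom : ∀ x : Fin N → Bool, ∑ i : Fin N, (evalBool p x - evalBool p (Function.update x i (!x i))) =
      4 * (A.queries : ℝ) * (evalBool p x - boolAvg (evalBool p))) :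
    ∃ i : Fin N, 4 * boolVariance p ^ 2 ≤ L ^ 2 * influence i p := by
  rcases eq_or_ne L 0 with hL | hL
  · -- `p` vanishes on the cube: both sides are `0`
    refine ⟨A.start.1, ?_⟩
    have hz : evalBool p = fun _ => 0 := funext fun x => by rw [hp x, hL, zero_mul]
    have hv : boolVariance p = 0 := by
      unfold boolVariance
      rw [hz, boolAvg_const]
      simp only [sub_self, zero_pow two_ne_zero, boolAvg_const]
    rw [hv, hL]
    simp only [zero_pow two_ne_zero, mul_zero, zero_mul, le_refl]
  · -- rescale: `a = L⁻¹ p` is the acceptance probability itself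
    have ha : ∀ x, evalBool (C L⁻¹ * p) x = A.acceptProb x := fun x => by
      rw [AddrWitness.evalBool_C_mul', hp x, ← mul_assoc, inv_mul_cancel₀ hL, one_mul]
    obtain ⟨i, hi⟩ := queryHomogeneousRung A hT (C L⁻¹ * p) ha (laplacian_C_mul L⁻¹ A.queries p hhom)
    refine ⟨i, ?_⟩
    rw [boolVariance_C_mul, influence_C_mul] at hi
    have hL2 : 0 < L ^ 2 := by positivity
    have hinv : L⁻¹ ^ 2 = (L ^ 2)⁻¹ := by rw [inv_pow]
    rw [hinv] at hi
    -- `hi : 4 (Var/L²)² ≤ Inf/L²`; multiply through by `L⁴`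
    have h1 : 4 * boolVariance p ^ 2 = (L ^ 2) ^ 2 * (4 * ((L ^ 2)⁻¹ * boolVariance p) ^ 2) := by
      field_simp
    have h2 : L ^ 2 * influence i p = (L ^ 2) ^ 2 * ((L ^ 2)⁻¹ * influence i p) := by
      field_simp
    rw [h1, h2]
    exact mul_le_mul_of_nonneg_left hi (by positivity)

/-- **Dilated top-weight bound (no homogeneity).**  For `p = L · acceptProb_A` on the cube (`A` a `T`-query
algorithm, `T ≥ 1`), some variable has `Inf_i[p] ≥ 4·(W^{=2T}[p])²/L²`, where
`W^{=2T}[p] = Σ_{|U| = 2T} p̂(U)²` is the Walsh weight of `p` on the top level.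
[cite: EscuderoGutierrez2023, Thm 1.6 (proof)] -/
theorem dilatedTopWeight_sq_le (A : QQueryAlg N) (hT : 1 ≤ A.queries) (p : MvPolynomial (Fin N) ℝ) (L : ℝ)
    (hp : ∀ x, evalBool p x = L * A.acceptProb x) :
    ∃ i : Fin N, 4 * (∑ U ∈ Finset.univ.filter (fun U : Finset (Fin N) => U.card = 2 * A.queries),
        cubeFourierCoeff (evalBool p) U ^ 2) ^ 2 ≤ L ^ 2 * influence i p := by
  rcases eq_or_ne L 0 with hL | hL
  · refine ⟨A.start.1, ?_⟩
    have hz : evalBool p = fun _ => (0 : ℝ) * 0 := funext fun x => by rw [hp x, hL, zero_mul, zero_mul]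
    have hc : ∀ U : Finset (Fin N), cubeFourierCoeff (evalBool p) U = 0 := fun U => by
      rw [hz, cubeFourierCoeff_const_mul', zero_mul]
    simp only [hc, hL, zero_pow two_ne_zero, Finset.sum_const_zero, mul_zero, zero_mul, le_refl]
  · have ha : ∀ x, evalBool (C L⁻¹ * p) x = A.acceptProb x := fun x => by
      rw [AddrWitness.evalBool_C_mul', hp x, ← mul_assoc, inv_mul_cancel₀ hL, one_mul]
    obtain ⟨i, hi⟩ := topWeight_sq_le_influence A hT (C L⁻¹ * p) ha
    refine ⟨i, ?_⟩
    have hcoef : ∀ U : Finset (Fin N), cubeFourierCoeff (evalBool (C L⁻¹ * p)) U =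
        L⁻¹ * cubeFourierCoeff (evalBool p) U := fun U => by
      rw [show evalBool (C L⁻¹ * p) = fun x => L⁻¹ * evalBool p x from
        funext (AddrWitness.evalBool_C_mul' L⁻¹ p)]
      exact cubeFourierCoeff_const_mul' _ _ _
    simp_rw [hcoef, influence_C_mul, mul_pow, ← Finset.mul_sum] at hi
    set W : ℝ := ∑ U ∈ Finset.univ.filter (fun U : Finset (Fin N) => U.card = 2 * A.queries),
      cubeFourierCoeff (evalBool p) U ^ 2
    have hL2 : 0 < L ^ 2 := by positivity
    have hinv : L⁻¹ ^ 2 = (L ^ 2)⁻¹ := by rw [inv_pow]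
    rw [hinv] at hi
    have h1 : 4 * W ^ 2 = (L ^ 2) ^ 2 * (4 * ((L ^ 2)⁻¹ * W) ^ 2) := by
      field_simp
    have h2 : L ^ 2 * influence i p = (L ^ 2) ^ 2 * ((L ^ 2)⁻¹ * influence i p) := by
      field_simp
    rw [h1, h2]
    exact mul_le_mul_of_nonneg_left hi (by positivity)

/-- **Dilation lower bound (contrapositive, quantitative form).**  If `p = L·acceptProb_A` for a `T`-query
algorithm `A` (`T ≥ 1`), `p` is top-homogeneous of order `T`, `Var[p] ≥ v ≥ 0` and every influence of `p` is at
most `τ`, then `4 v² ≤ L² τ`: realising a top-homogeneous polynomial with large variance and uniformly small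
influences as a (scaled) `T`-query acceptance probability needs dilation `L ≥ 2v/√τ`.
[cite: EscuderoGutierrez2023, Cor 1.7] -/
theorem dilation_sq_ge (A : QQueryAlg N) (hT : 1 ≤ A.queries) (p : MvPolynomial (Fin N) ℝ) (L : ℝ)
    (hp : ∀ x, evalBool p x = L * A.acceptProb x)
    (hhom : ∀ x : Fin N → Bool, ∑ i : Fin N, (evalBool p x - evalBool p (Function.update x i (!x i))) =
      4 * (A.queries : ℝ) * (evalBool p x - boolAvg (evalBool p)))
    {v τ : ℝ} (hv0 : 0 ≤ v) (hv : v ≤ boolVariance p) (hτ : ∀ i : Fin N, influence i p ≤ τ) :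
    4 * v ^ 2 ≤ L ^ 2 * τ := by
  obtain ⟨i, hi⟩ := dilatedHomogeneousRung A hT p L hp hhom
  calc 4 * v ^ 2 ≤ 4 * boolVariance p ^ 2 := by gcongr
    _ ≤ L ^ 2 * influence i p := hi
    _ ≤ L ^ 2 * τ := mul_le_mul_of_nonneg_left (hτ i) (sq_nonneg L)

end Summit.QuantumAdvantage.QuantumAdvantage.Theorems.SosSandwich.QueryDilation

end
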